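import Summits.HubbardSuperconductivity.HubbardSuperconductivity.Theses.CooperPairDMottWalk
import Summits.HubbardSuperconductivity.HubbardSuperconductivity.Theorems.CooperPairDMottWalkBreathingAtOneIsPure

/-!
# Line `birth` — BC3 skeleton for the crux `BindingWalk` (stmt-HubbardSuperconductivity-1176)

Route `CooperPairDMottWalk` (route-HubbardSuperconductivity-CooperPairDMottWalk), crux (rank 2)
`BindingWalk` — THE WALK: on the breathing/checkerboard family
`H_L(a,b,U) = -a·T_intra - b·T_inter + U·D` (`Hb L a b U`; intra = n.n. bonds inside the 2×2
plaquettes `{2m,2m+1}²` of the torus of side `L = 4k+4`, inter = the remaining n.n. bonds),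
IF for some `U₀ ∈ [2,4]` and all small `b` the plaquette-end model `H_L(1,b,U₀)` carries the
Cooper-pair package `CP` — (a) two-hole pair binding `E(L²-2,0) + E(L²,0) + ε ≤ 2E(L²-1,½)`,
(b) unique ground state of the `(L²-2, S^z=0)` sector, (c) macroscopic `d_{x²-y²}` amplitude
`|⟨ψ₂, Δ_d ψ₀⟩|² ≥ z L² ‖ψ₀‖²‖ψ₂‖²` — uniformly in `L = 4k+4` (the conclusion of the corner crux
`CooperPairDMott`), THEN the PURE torus `hubbardTorus 2 L 1 U` carries it for some `U ∈ [2,8]`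
(= the target `PureCooperPair`).

## THE LINE — "walk to the point of maximal binding with the whole package, cross the junction
## with energies only, re-select the d-wave channel at the self-dual point"

A proof of `BindingWalk` by continuation has to do three logically independent things, and the
skeleton names exactly these three as stubs (vocabulary `CP`, `Binding`, `Hb`, `WalkPoint`,
`BindingPoint`, `PureBinding`, `PureCooper`, `Corner` below is the route's `let CP` / `let Hb`
VERBATIM, so that the composition concludes the crux by `rfl`-transport):

* `stub_dMottLeg` (S1 — the d-MOTT LEG, continuation INSIDE the plaquette-singlet phase, size XL):
  `Corner → ∃ U₁ ∈ [2,8], WalkPoint U₁ (1/2)`: from the perturbative corner (`b < b₀(U₀) ~ 10⁻²`,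
  `U₀ ∈ [2,4]`) the FULL package (a)∧(b)∧(c) is carried, moving in the `(b,U)`-plane as needed
  (raising `U` up to `8` is allowed), to the HAND-OFF POINT `b = 1/2` — the inter/intra ratio at
  which the 4×4 pair-binding energy of the checkerboard Hubbard model is MAXIMAL
  (`Δ_pb = 0.32t` at `U = 8t, t′ = 0.5t`, arXiv:0803.0933 abstract and p.3, "remarkable degree of
  insensitivity to boundary conditions for t′/t ≤ 0.8"), and which lies deep inside the gapped
  plaquette (quadrumerised) phase of the half-filled parent at strong coupling
  (`J_inter/J_intra = b² = 1/4` against the critical ratio `1/α_c = 1/1.8230 = 0.5485`,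
  i.e. `b_AF(U→∞) = √0.5485 ≈ 0.74`; arXiv:0808.1418 = doi:10.1103/physrevb.79.014410, abstract).
  Along this leg the parent stays unique and gapped and the two-hole level stays isolated below
  the two-holon continuum, so the d-wave quantum numbers cannot change ("for all U and t′ < t the
  ground-state symmetry alternates A1 (M=0), B1 (M=2), A1 (M=4)", arXiv:0803.0933 p.5): the
  engines are spectral-flow / quasi-adiabatic continuation inside a gapped phase
  [BachmannMichalakisNachtergaeleSims arXiv:1102.0842; De Roeck–Salmhofer arXiv:1712.00977;
  Koma2020GapStability; NSY arXiv:1705.08553] — but far beyond the convergence radius of the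
  corner expansion (fifty times `b₀`), so a non-perturbative (possibly computer-assisted, with
  certified finite-size transfer) continuation is needed. Why it might fail: the plaquette phase
  of the parent may end below `b = 1/2` for every `U ≤ 8` at which the corner pair exists
  (plaquette binding needs `U < U_c ≈ 4.6` at `b → 0`, arXiv:0803.0933 p.4; the leg must first
  raise `b`, then `U`), or the two-hole level may merge with the continuum on the way.
* `stub_junctionLeg` (S2 — the JUNCTION, ENERGIES ONLY, size XL; carries the crux's named open
  point): `∀ U₁ ∈ [2,8], WalkPoint U₁ (1/2) → ∃ U ∈ [2,8], BindingPoint U 1`: from the hand-off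
  point the walk continues to the self-dual point `(a,b) = (1,1)` THROUGH the parent's
  plaquette-singlet → Néel transition `b_AF(U)`, but it only has to carry clause (a), the
  pair-binding ENERGY `2E(L²-1,½) - E(L²,0) - E(L²-2,0) ≥ ε > 0` — a combination of sector minima
  `minEnergyOn`, each the minimum of affine functions of `(b,U)` (concave, Lipschitz), accessible
  to two-sided variational / certified bounds, and for the half-filled term to sign-free QMC —
  not the eigenvector clauses (b),(c), which are intractable across a gap closing. Why it might
  fail = the crux's: pure-model two-hole binding may tend to `0` as `L → ∞` for every `U ≤ 8`
  (t-J ED: `|E_b|` shrinks 16 → 32 sites, cond-mat/9806018 §3.2; 4×4 `Δ_pb` boundary-condition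
  sensitive for `t′/t > 0.8`, "the most speculative portion", arXiv:0803.0933 p.7; the refuter's
  2×4 two-plaquette ED on this item, kit j000082, sees binding turn negative before `b = 1` at
  `U ≤ 4` — hence the freedom `U ∈ [2,8]` in the conclusion is essential).
* `stub_dWaveSelection` (S3 — CHANNEL SELECTION AT THE SELF-DUAL POINT, size L–XL):
  `∀ U ∈ [2,8], PureBinding U → PureCooper U`: in the PURE repulsive Hubbard torus (`t′ = 0`),
  wherever two doped holes bind uniformly in `L = 4k+4`, the two-hole sector ground state is
  unique (a `K = 0` spin singlet of `B₁g` symmetry relative to the Lieb-unique half-filled ground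
  state) and has macroscopic nearest-neighbour `d_{x²-y²}` amplitude `z L²` — clauses (b),(c)
  re-derived at the endpoint from binding plus the full symmetry (translations × C₄ᵥ × SU(2))
  that the breathing family lacks and the pure point regains. Why it might fail: a bound pair in
  another channel — near-degenerate `p`-wave / `K = (π,π)` two-hole states and level crossings at
  small `J/t` (cond-mat/0201031 = doi:10.1103/physrevb.65.205101; cond-mat/9806018), or vanishing
  nearest-neighbour weight of a `B₁g` pair; no Perron–Frobenius sign structure is available in
  the two-hole sector to force uniqueness. Sources for: arXiv:0803.0933 p.5 (A1/B1 alternation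
  ⇒ the connecting pair operator is `d_{x²-y²}`), RaghuKivelsonScalapino2010 (weak-coupling
  `d_{x²-y²}` dominance near half filling), Dagotto RMP 66 (1994) 763 §IV.

Composition `BindingWalk_of : Sig.stub_dMottLeg → Sig.stub_junctionLeg → Sig.stub_dWaveSelection →
BindingWalk` (sorry-free; the stubs enter BY NAME through their `Sig.*` statements) and
`BindingWalk_proof : BindingWalk` (the crux BY NAME from the three registered stubs): S1 takes the
corner to the hand-off point, S2 to uniform binding of `Hb L 1 1 U`, the PROVED route support
`BreathingAtOneIsPure` (`Theorems.CooperPairDMottWalk.breathingAtOneIsPure_proof`: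
`Hb L 1 1 U = hubbardTorus 2 L 1 U`) rewrites that into pure-model binding, and S3 restores the
full package; the crux's inline `let CP` / `let Hb` are this file's `CP` / `Hb` by `rfl`.
`sorry` occurs ONLY in the three `stub_*` theorems (lean check: sorries = 3 = stubs).

BC3 probes (planner folder `bc/probe_stub_*.lean`, stub signature alone in scope): for each of the
three stubs, `stub → BindingWalk` and `stub → HubbardSuperconductivity` by each of `exact?`,
`simpa [stub]`, `(unfold stub; simpa)`, `aesop` FAIL (24/24; `exact?`/`aesop` on S1 → crux time out
at 400k and 2M heartbeats, all others "could not close the goal" / "assumption failed" /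
"aesop: failed to prove the goal"). No stub is cheaply the crux or the summit: S1 lacks the
junction, S2 lacks the corner-to-hand-off leg and the eigenvector clauses, S3 ignores the corner.

Disproof used: none on record — `ledger crux ls stmt-HubbardSuperconductivity-1176` shows no
`Disproof.lean` and no `Theorems/BindingWalk/Negative/*` at registration (2026-08-17); negatives
index of the summit (stmt-1180 `BreathingSelfDual`, refuted at the degenerate side `L = 2`;
stmt-1314 KLS order openness) is not touched: every stub lives on sides `L = 4k+4 ≥ 4` and none
asserts a unitary self-duality. The refuter evidence on the item (two-plaquette ED, kit j000082:
binding lost before `b = 1` at `U ≤ 4`) is honoured by letting both legs move `U` within `[2,8]`.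
-/

noncomputable section

-- `Summit.<Summit>.<Problem>`: for the single-conjunct summit the duplicate component is mandated.
set_option linter.dupNamespace false

namespace Summit.HubbardSuperconductivity.HubbardSuperconductivity.Cruxes.BindingWalk.Birth

open scoped Matrix
open Literature.Hubbard
open Literature.MathematicalPhysics.QuantumLattice
open Summit.HubbardSuperconductivity.HubbardSuperconductivity.Theses.CooperPairDMottWalk

/-! ## Vocabulary (the route's `let CP` / `let Hb`, verbatim) -/

/-- The Cooper-pair package `CP L H ε z` of the route (verbatim its `let CP`): (a) two-hole pair
binding with margin `ε`, (b) uniqueness up to phase of the `(L²-2, S^z=0)`-sector ground state,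
(c) `d_{x²-y²}` pair amplitude `≥ z L²` between the half-filled and the two-hole sector ground
states. [cite: arXiv:0803.0933, eq. (2)] [cite: Scalapino1995, §2] -/
def CP (L : ℕ) [NeZero L]
    (H : Matrix (Finset (Orb (FermionTorus 2 L))) (Finset (Orb (FermionTorus 2 L))) ℂ) (ε z : ℝ) :
    Prop :=
  H.minEnergyOn (szSector (L ^ 2 - 2) 0) + H.minEnergyOn (szSector (L ^ 2) 0) + ε ≤
        2 * H.minEnergyOn (szSector (L ^ 2 - 1) (1 / 2)) ∧
    (∀ φ₁ φ₂, IsGroundStateInSector H (L ^ 2 - 2) 0 φ₁ → IsGroundStateInSector H (L ^ 2 - 2) 0 φ₂ →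
        ∃ c : ℂ, φ₂ = c • φ₁) ∧
    (∀ φ₀ φ₂, IsGroundStateInSector H (L ^ 2) 0 φ₀ → IsGroundStateInSector H (L ^ 2 - 2) 0 φ₂ →
        z * (L : ℝ) ^ 2 * (star φ₀ ⬝ᵥ φ₀).re * (star φ₂ ⬝ᵥ φ₂).re ≤
          ‖star φ₂ ⬝ᵥ (pairField dWaveFormFactor L *ᵥ φ₀)‖ ^ 2)

/-- Clause (a) of `CP` alone: the two-hole pair-binding inequality
`E(L²-2,0) + E(L²,0) + ε ≤ 2E(L²-1,½)` (`Δ_pb ≥ ε`, arXiv:0803.0933 eq. (2) at one hole pair).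
[cite: arXiv:0803.0933, eq. (2)] -/
def Binding (L : ℕ) [NeZero L]
    (H : Matrix (Finset (Orb (FermionTorus 2 L))) (Finset (Orb (FermionTorus 2 L))) ℂ) (ε : ℝ) :
    Prop :=
  H.minEnergyOn (szSector (L ^ 2 - 2) 0) + H.minEnergyOn (szSector (L ^ 2) 0) + ε ≤
    2 * H.minEnergyOn (szSector (L ^ 2 - 1) (1 / 2))

/-- The breathing / checkerboard family `H_L(a,b,U)` (verbatim the route's `let Hb`): hopping `a`
on intra-plaquette bonds with the on-site repulsion `U`, hopping `b` on inter-plaquette bonds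
(no second interaction term). [cite: TsaiKivelson2006] [cite: arXiv:0803.0933, Fig. 1] -/
def Hb (L : ℕ) (a b U : ℝ) :
    Matrix (Finset (Orb (FermionTorus 2 L))) (Finset (Orb (FermionTorus 2 L))) ℂ :=
  hamiltonian (fermionTorusGraph 2 L \ (⊤ : SimpleGraph (Fin 2 → ℕ)).comap
      (fun (x : FermionTorus 2 L) (i : Fin 2) => (ofLex x i : ℕ) / 2)) a U +
    hamiltonian (fermionTorusGraph 2 L ⊓ (⊤ : SimpleGraph (Fin 2 → ℕ)).comap
      (fun (x : FermionTorus 2 L) (i : Fin 2) => (ofLex x i : ℕ) / 2)) b 0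

/-- `W(U,b)`: the full Cooper-pair package holds for `H_L(1,b,U)`, uniformly in `L = 4k+4`
(a point of the walk). [folklore] -/
def WalkPoint (U b : ℝ) : Prop :=
  ∃ ε > (0 : ℝ), ∃ z > (0 : ℝ), ∃ k₀ : ℕ, ∀ k ≥ k₀, CP (4 * k + 4) (Hb (4 * k + 4) 1 b U) ε z

/-- Uniform two-hole BINDING (clause (a) only) for `H_L(1,b,U)`, `L = 4k+4`. [folklore] -/
def BindingPoint (U b : ℝ) : Prop :=
  ∃ ε > (0 : ℝ), ∃ k₀ : ℕ, ∀ k ≥ k₀, Binding (4 * k + 4) (Hb (4 * k + 4) 1 b U) ε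

/-- Uniform two-hole binding for the PURE torus `hubbardTorus 2 L 1 U`, `L = 4k+4`. [folklore] -/
def PureBinding (U : ℝ) : Prop :=
  ∃ ε > (0 : ℝ), ∃ k₀ : ℕ, ∀ k ≥ k₀, Binding (4 * k + 4) (hubbardTorus 2 (4 * k + 4) 1 U) ε

/-- The full Cooper-pair package for the PURE torus at repulsion `U` (the body of the route's
target `PureCooperPair` at fixed `U`). [folklore] -/
def PureCooper (U : ℝ) : Prop :=
  ∃ ε > (0 : ℝ), ∃ z > (0 : ℝ), ∃ k₀ : ℕ, ∀ k ≥ k₀, CP (4 * k + 4) (hubbardTorus 2 (4 * k + 4) 1 U) ε z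

/-- The corner hypothesis of the crux (verbatim): for some `U₀ ∈ [2,4]` and all small `b`, the
plaquette-end model `H_L(1,b,U₀)` has the Cooper-pair package uniformly in `L = 4k+4`
(= the conclusion of `CooperPairDMott` at `U₀`). [cite: TsaiKivelson2006] -/
def Corner : Prop :=
  ∃ U₀ ∈ Set.Icc (2 : ℝ) 4, ∃ b₀ > (0 : ℝ), ∀ b ∈ Set.Ioo 0 b₀, WalkPoint U₀ b

/-! ## Stub signatures (`Sig.stub_*`, so that the hypotheses of `BindingWalk_of` carry the
registered stub names) -/

/-- STUB S1 — THE d-MOTT LEG (continuation inside the plaquette-singlet phase to the point of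
maximal binding; open, size XL). From the corner, the FULL package (a)∧(b)∧(c) persists, moving in
the `(b,U)`-plane with `U` allowed up to `8`, to the hand-off point `b = 1/2` at some `U₁ ∈ [2,8]`.
Why plausible: `b = 1/2` is where the 4×4 pair binding of the checkerboard Hubbard model is
maximal and boundary-condition insensitive (arXiv:0803.0933, abstract, p.3) and it lies inside the
gapped plaquette phase of the strong-coupling parent (`b² = 1/4 < 0.5485 = 1/α_c`,
arXiv:0808.1418); inside that phase the two-hole level is isolated and its quantum numbers are
frozen (A1/B1/A1 alternation for all `U`, `t′ < t`, arXiv:0803.0933 p.5). Why it might fail: the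
plaquette phase may end below `b = 1/2` for every `U ≤ 8` reachable from the corner window
`U₀ < U_c ≈ 4.6` (arXiv:0803.0933 p.4), or the level may touch the two-holon continuum en route;
no non-perturbative continuation theorem of this reach exists (engines: arXiv:1102.0842,
arXiv:1712.00977, arXiv:1705.08553, Koma2020GapStability cover gapped ground states, not a doped
two-body level fifty convergence radii away). -/
def Sig.stub_dMottLeg : Prop :=
  Corner → ∃ U₁ ∈ Set.Icc (2 : ℝ) 8, WalkPoint U₁ (1 / 2)

/-- STUB S2 — THE JUNCTION LEG, ENERGIES ONLY (the crux's named open point; size XL). From the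
full package at the hand-off point `(b,U₁) = (1/2, U₁)`, `U₁ ∈ [2,8]`, uniform two-hole BINDING
(clause (a) alone) persists to the self-dual point `(a,b) = (1,1)` of the breathing family at some
`U ∈ [2,8]` — across the parent's plaquette-singlet → Néel transition `b_AF(U) ≈ 0.74`. Only sector
minima `minEnergyOn` are carried (concave and Lipschitz in `(b,U)`, open to two-sided variational /
certified bounds; the half-filled term is sign-free), not eigenvectors. Why it might fail: the
pure-model two-hole binding may vanish as `L → ∞` for all `U ≤ 8` (t-J ED `|E_b|` shrinks 16→32
sites, cond-mat/9806018 §3.2; 4×4 `Δ_pb` boundary-sensitive for `t′/t > 0.8`, arXiv:0803.0933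
pp.3,7; refuter 2×4 ED kit j000082 on this item: binding negative before `b = 1` at `U ≤ 4`).
Sources: arXiv:0803.0933, doi:10.1103/physrevb.83.054508, doi:10.1103/PhysRevB.90.075121,
doi:10.1103/physrevb.79.014410. -/
def Sig.stub_junctionLeg : Prop :=
  ∀ U₁ ∈ Set.Icc (2 : ℝ) 8, WalkPoint U₁ (1 / 2) → ∃ U ∈ Set.Icc (2 : ℝ) 8, BindingPoint U 1

/-- STUB S3 — d-WAVE CHANNEL SELECTION AT THE SELF-DUAL (PURE) POINT (size L–XL). For every
`U ∈ [2,8]`: if two doped holes bind uniformly in `L = 4k+4` in the PURE torus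
`hubbardTorus 2 L 1 U`, then the full package holds there — the `(L²-2, S^z=0)`-sector ground
state is unique up to phase and has `d_{x²-y²}` amplitude `≥ z L²` against the Lieb-unique
half-filled ground state (a `K = 0`, `B₁g` singlet pair with non-vanishing nearest-neighbour
weight). The pure point regains the full translation × `C₄ᵥ` × `SU(2)` symmetry the breathing
family lacks; this stub is where it is spent. Why it might fail: a bound pair in another channel
(`p`-wave / `K = (π,π)` near-degeneracies and level crossings at small `J/t`,
doi:10.1103/physrevb.65.205101, doi:10.1103/physrevb.58.13594) or a `B₁g` pair with vanishing
nearest-neighbour weight; no sign structure forces uniqueness in the two-hole sector. Sources for: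
arXiv:0803.0933 p.5, RaghuKivelsonScalapino2010, LiebPRL1989 (uniqueness of the half-filled
parent). -/
def Sig.stub_dWaveSelection : Prop :=
  ∀ U ∈ Set.Icc (2 : ℝ) 8, PureBinding U → PureCooper U

/-! ## Registered stubs (the ONLY `sorry`s of this file) -/

/-- Registered stub S1 (d-Mott leg: corner → hand-off point `b = 1/2`, full package). -/
theorem stub_dMottLeg : Sig.stub_dMottLeg := by
  sorry

/-- Registered stub S2 (junction leg: hand-off point → self-dual point, energies only). -/
theorem stub_junctionLeg : Sig.stub_junctionLeg := by
  sorry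

/-- Registered stub S3 (d-wave channel selection at the pure point). -/
theorem stub_dWaveSelection : Sig.stub_dWaveSelection := by
  sorry

/-! ## Sorry-free infrastructure -/

/-- The breathing family at `(a,b) = (1,1)` IS the pure torus — the route's PROVED support item
`BreathingAtOneIsPure` (stmt-HubbardSuperconductivity-1179,
`Theorems.CooperPairDMottWalk.breathingAtOneIsPure_proof`), transported to this file's `Hb` by
`rfl`. [folklore] -/
theorem Hb_one_one (L : ℕ) (U : ℝ) : Hb L 1 1 U = hubbardTorus 2 L 1 U :=
  Theorems.CooperPairDMottWalk.breathingAtOneIsPure_proof L U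

/-- The walk in this file's vocabulary (sorry-free modulo its hypotheses): corner —S1→ full
package at `(1/2, U₁)` —S2→ uniform binding of `Hb L 1 1 U` = (by `Hb_one_one`) of the pure torus
—S3→ the full pure-model package at `U ∈ [2,8]`. [folklore] -/
theorem pureCooper_of_stubs (h1 : Sig.stub_dMottLeg) (h2 : Sig.stub_junctionLeg)
    (h3 : Sig.stub_dWaveSelection) (hc : Corner) : ∃ U ∈ Set.Icc (2 : ℝ) 8, PureCooper U := by
  -- S1: the d-Mott leg delivers the hand-off point
  obtain ⟨U₁, hU₁, hW⟩ := h1 hc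
  -- S2: the junction leg delivers uniform binding at the self-dual point of the family
  obtain ⟨U, hU, ε, hε, k₀, hB⟩ := h2 U₁ hU₁ hW
  -- the self-dual point is the pure model (proved support `BreathingAtOneIsPure`)
  have hpure : PureBinding U := by
    refine ⟨ε, hε, k₀, fun k hk => ?_⟩
    have h := hB k hk
    rw [Hb_one_one] at h
    exact h
  -- S3: channel selection restores the full package at the pure point
  exact ⟨U, hU, h3 U hU hpure⟩

/-! ## The composition: the three stubs prove the crux BY NAME -/

/-- **THE SKELETON THEOREM.** `Sig.stub_dMottLeg → Sig.stub_junctionLeg → Sig.stub_dWaveSelection →`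
`Summit.HubbardSuperconductivity.HubbardSuperconductivity.Theses.CooperPairDMottWalk.BindingWalk`,
a real proof (no `sorry`; axioms `propext`, `Classical.choice`, `Quot.sound` only): the crux's
inline `let CP` / `let Hb` are definitionally this file's `CP` / `Hb`, so its hypothesis IS `Corner`
and its conclusion IS `∃ U ∈ [2,8], PureCooper U`, which `pureCooper_of_stubs` provides. Every
stub is consumed. [folklore] -/
theorem BindingWalk_of :
    Sig.stub_dMottLeg → Sig.stub_junctionLeg → Sig.stub_dWaveSelection → BindingWalk :=
  fun h1 h2 h3 hc => pureCooper_of_stubs h1 h2 h3 hc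

/-- The skeleton in its final shape: the crux BY NAME from the three registered stubs; it becomes
the crux proof when the last `stub_*` is discharged (until then it depends on `sorryAx` through
the stubs only — no `sorry` of its own). [folklore] -/
theorem BindingWalk_proof : BindingWalk :=
  BindingWalk_of stub_dMottLeg stub_junctionLeg stub_dWaveSelection

end Summit.HubbardSuperconductivity.HubbardSuperconductivity.Cruxes.BindingWalk.Birth

end
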